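import Mathlib
import Summits.Schanuel.Schanuel.Theses.RigidCore
import Summits.Schanuel.Schanuel.Theorems.AclSubsetLogFreeCore.Negative.LogFreeCoreCountable
import Literature.Barriers.Schanuel.AlgebraicIndependenceOfLogarithms
import Literature.Barriers.Schanuel.LargeTranscendenceDegreeSmallTrdegProofs
import Literature.Barriers.Schanuel.NesterenkoModularScopeConjectureProofs

/-!
# Line `kernel-tower-relative-lw`: RelLW₀ follows from Schanuel over ℚ(π)^{ralg} (level 0 isolated)

Registered stub `stub_relLWZero_of_schanuelOnStageZero` of line `kernel-tower-relative-lw` of crux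
`stmt-Schanuel-0970` (`Summit.Schanuel.Schanuel.Theses.RigidCore.SchanuelOnLogFreeCore`, (R) =
Schanuel's conjecture for `ℚ`-linearly independent tuples from the log-free core
`C_EA = logFreeCore`).  The level-`0` layer `RelLW₀` of the line says: exponentials of elements of
`L₀ = stage 0 = ℚ(2πi)^{ralg} = ℚ(π)^{ralg}` that are `ℚ`-linearly independent MODULO `ℚ·2πi` are
algebraically independent OVER `L₀`.

The landed calibration `stub_relLWZero_of_crux` (`RigidCoreSchanuelOnLogFreeCoreRelLWZeroOfCrux`)
derives `RelLW₀` from (R), but its proof applies (R) exactly ONCE, to the tuple `(2πi, u)`, all of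
whose entries lie in `stage 0`.  Hence the same argument derives `RelLW₀` from the WEAKER
hypothesis `SC|_{L₀}` = Schanuel's statement for `ℚ`-linearly independent tuples taken from
`stage 0` only; that is the present file (`stub_relLWZero_of_schanuelOnStageZero`, signature
verbatim).  Together with the skeleton's sorry-free level-`0` sector split at the kernel line
(`schanuelOnStageZero_of_relLWZero`, i.e. `RelLW₀ ⟹ SC|_{L₀}`) it certifies

  `RelLW₀ ⟺ SC|_{L₀}` = "Schanuel's conjecture for `ℚ`-linearly independent tuples of numbers
  algebraic over `ℚ(π)`"

(`relLWZero_iff_schanuelOnStageZero` in the skeleton): the first open layer of the crux, isolated.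
The corollary `KernelTower.schanuelOnStageZero_of_crux` records the trivial restriction
`(R) ⟹ SC|_{L₀}` along `stage 0 ≤ logFreeCore`.

Proof.  Let `τ = 2πi` and `u ⊂ L₀` be independent modulo `ℚ·τ`.
1. `x = (τ, u)` lies in `L₀` and is `ℚ`-linearly independent
   (a relation `c₀τ + ∑ cᵢuᵢ = 0` read modulo `ℚ·τ` kills the `cᵢ`, then `c₀ = 0` as `τ ≠ 0`).
2. `SC|_{L₀}` gives `r + 1 ≤ trdeg ℚ(x, e^x)`, and `ℚ(x, e^x) ≤ ℚ(τ, e^u, u)` (`e^τ = 1`).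
3. Every `uᵢ` is algebraic over `F = ℚ(τ)`, so `trdeg ℚ(τ, e^u, u) = trdeg ℚ(τ, e^u)
   = trdeg ℚ(τ) + trdeg_F F(e^u) ≤ 1 + trdeg_F F(e^u)` (tower law), whence `r ≤ trdeg_F F(e^u)`.
4. Hence `e^u` is algebraically independent over `F`
   (`Literature.Barriers.Schanuel.algebraicIndependent_of_le_trdeg_adjoin`), and therefore over the
   algebraic extension `L₀ = F^{ralg}` of `F` (Mathlib `AlgebraicIndependent.algebraicClosure`).

Design.  The landed module `RigidCoreSchanuelOnLogFreeCoreRelLWZeroOfCrux` was not yet built on the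
Lean farm when this file was checked, so its field-theoretic helpers (`RelLWZeroOfCrux.*`) could
not be imported; rather than re-declaring them (duplicates), the tower-law count and the extension
of `u` to the `ℚ`-free tuple `(τ, u)` are carried out INSIDE the proof of
`RelLWZeroOfSchanuelOnStageZero.algebraicIndependent_exp_over_adjoin`, the invariance of `trdeg`
under relatively algebraic adjunctions being the Literature lemma
`Literature.Barriers.Schanuel.trdeg_adjoin_union_eq_of_isAlgebraic_adjoin`.  Everything used is
proved in the tree / Mathlib; `SC|_{L₀}` is the hypothesis.  No new definitions.
-/

noncomputable section

open IntermediateField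
open Summit.Schanuel.Schanuel.Theorems.AclSubsetLogFreeCore.Negative

namespace Summit.Schanuel.Schanuel.Theorems.RigidCore

namespace RelLWZeroOfSchanuelOnStageZero

/-- **The count under `SC|_{L₀}`**: for `u ⊂ L₀` independent modulo `ℚ·2πi`, the exponentials
`e^u` are algebraically independent over `F = ℚ(2πi)` — Schanuel's statement for tuples from
`L₀ = stage 0`, applied at the `ℚ`-free tuple `(2πi, u) ⊂ L₀`, gives
`r + 1 ≤ trdeg ℚ(2πi, u, 1, e^u) = trdeg ℚ(2πi, e^u) = trdeg ℚ(2πi) + trdeg_F F(e^u)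
≤ 1 + trdeg_F F(e^u)` (`u` algebraic over `F`; tower law `trdeg_add_eq` along
`ℚ ⊆ ℚ(S) ⊆ ℚ(S)(T) = ℚ(S ∪ T)`), so `r ≤ trdeg_F F(e^u)` and
`Literature.Barriers.Schanuel.algebraicIndependent_of_le_trdeg_adjoin` applies.  (Same proof as
the landed `RelLWZeroOfCrux.algebraicIndependent_exp_over_adjoin`, with (R) weakened to
`SC|_{L₀}` and the helpers inlined.) [folklore] -/
theorem algebraicIndependent_exp_over_adjoin
    (hS0 : ∀ (n : ℕ) (x : Fin n → ℂ), (∀ i, x i ∈ stage 0) → LinearIndependent ℚ x →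
      (n : Cardinal) ≤ Algebra.trdeg ℚ ↥(adjoin ℚ (Set.range x ∪ Set.range (Complex.exp ∘ x))))
    (r : ℕ) (u : Fin r → ℂ) (hu : ∀ i, u i ∈ stage 0)
    (hli : LinearIndependent ℚ
      ((Submodule.span ℚ ({(2 * ↑Real.pi * Complex.I : ℂ)} : Set ℂ)).mkQ ∘ u)) :
    AlgebraicIndependent (↥(adjoin ℚ ({(2 * ↑Real.pi * Complex.I : ℂ)} : Set ℂ)))
      (fun i => Complex.exp (u i)) := by
  -- (0) the counting step, in pure field theory (kept generic in the base field `K`, so that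
  -- no `ℚ`-algebra instance path is fixed prematurely): if `L` with `r + 1 ≤ trdeg_K L` lies in
  -- `K(S ∪ T ∪ U)`, `U` is algebraic over `K(S ∪ T)` and `trdeg_K K(S) ≤ 1`, then
  -- `r ≤ trdeg_{K(S)} K(S)(T)`
  have hcount_of : ∀ {K E : Type} [Field K] [Field E] [Algebra K E] (S T U : Set E)
      {L : IntermediateField K E}, (r : Cardinal) + 1 ≤ Algebra.trdeg K L →
        L ≤ adjoin K ((S ∪ T) ∪ U) → (∀ a ∈ U, IsAlgebraic (↥(adjoin K (S ∪ T))) a) →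
          Algebra.trdeg K ↥(adjoin K S) ≤ 1 →
            (r : Cardinal) ≤ Algebra.trdeg ↥(adjoin K S) ↥(adjoin (↥(adjoin K S)) T) := by
    intro K E _ _ _ S T U L hr hL hU hS
    -- tower law `trdeg_K K(S ∪ T) = trdeg_K K(S) + trdeg_{K(S)} K(S)(T)` (`trdeg_add_eq` along
    -- `K ⊆ K(S) ⊆ K(S)(T) = K(S ∪ T)`, `adjoin_adjoin_left`)
    haveI : FaithfulSMul (↥(adjoin K S)) (↥(adjoin (↥(adjoin K S)) T)) :=
      (faithfulSMul_iff_algebraMap_injective _ _).mpr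
        (algebraMap (↥(adjoin K S)) (↥(adjoin (↥(adjoin K S)) T))).injective
    have htower := trdeg_add_eq K (adjoin K S) (A := adjoin (adjoin K S) T)
    have heq : Algebra.trdeg K (adjoin (adjoin K S) T) = Algebra.trdeg K (adjoin K (S ∪ T)) := by
      rw [← (equivOfEq (adjoin_adjoin_left K S T)).trdeg_eq]
      rfl
    have hST : Algebra.trdeg K ↥(adjoin K (S ∪ T)) = Algebra.trdeg K ↥(adjoin K S) +
        Algebra.trdeg ↥(adjoin K S) ↥(adjoin (↥(adjoin K S)) T) := by
      rw [← heq, ← htower]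
    rw [← Cardinal.add_one_le_add_one_iff]
    calc (r : Cardinal) + 1 ≤ Algebra.trdeg K L := hr
      _ ≤ Algebra.trdeg K ↥(adjoin K ((S ∪ T) ∪ U)) := Literature.Barriers.Schanuel.trdeg_mono hL
      _ = Algebra.trdeg K ↥(adjoin K (S ∪ T)) :=
          Literature.Barriers.Schanuel.trdeg_adjoin_union_eq_of_isAlgebraic_adjoin _ _ hU
      _ = Algebra.trdeg K ↥(adjoin K S) +
            Algebra.trdeg ↥(adjoin K S) ↥(adjoin (↥(adjoin K S)) T) := hST
      _ ≤ 1 + Algebra.trdeg ↥(adjoin K S) ↥(adjoin (↥(adjoin K S)) T) := add_le_add hS le_rfl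
      _ = Algebra.trdeg ↥(adjoin K S) ↥(adjoin (↥(adjoin K S)) T) + 1 := add_comm _ _
  -- (1) the tuple `(2πi, u)` lies in `L₀ = stage 0` and is `ℚ`-linearly independent
  have hstage :
      ∀ i, (Fin.cons (2 * (Real.pi : ℂ) * Complex.I) u : Fin (r + 1) → ℂ) i ∈ stage 0 := by
    intro i
    refine Fin.cases ?_ (fun j => ?_) i
    · rw [Fin.cons_zero]
      exact two_pi_I_mem_stage_zero
    · rw [Fin.cons_succ]
      exact hu j
  have hxli :
      LinearIndependent ℚ (Fin.cons (2 * (Real.pi : ℂ) * Complex.I) u : Fin (r + 1) → ℂ) := by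
    -- a relation `c₀τ + ∑ cᵢuᵢ = 0` read modulo `ℚ·τ` kills the `cᵢ`, then `c₀ = 0` as `τ ≠ 0`
    refine linearIndependent_finCons.mpr ⟨LinearIndependent.of_comp _ hli, fun hmem => ?_⟩
    obtain ⟨c, hc⟩ := (Submodule.mem_span_range_iff_exists_fun ℚ).mp hmem
    have hsum : ∑ i, c i •
        ((Submodule.span ℚ ({(2 * (Real.pi : ℂ) * Complex.I)} : Set ℂ)).mkQ ∘ u) i = 0 := by
      have h1 : (Submodule.span ℚ ({(2 * (Real.pi : ℂ) * Complex.I)} : Set ℂ)).mkQ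
          (∑ i, c i • u i) = 0 := by
        rw [hc, Submodule.mkQ_apply, Submodule.Quotient.mk_eq_zero]
        exact Submodule.mem_span_singleton_self _
      simpa only [map_sum, map_smul, Function.comp_apply] using h1
    have hc0 : ∀ i, c i = 0 := Fintype.linearIndependent_iff.mp hli c hsum
    refine two_pi_I_ne_zero' ?_
    rw [← hc]
    exact Finset.sum_eq_zero fun i _ => by rw [hc0 i, zero_smul]
  -- (2) Schanuel over `L₀` at `(2πi, u)`
  have hSx := hS0 (r + 1) (Fin.cons (2 * (Real.pi : ℂ) * Complex.I) u) hstage hxli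
  -- (3) `ℚ(x, e^x) ≤ ℚ(2πi, e^u, u)` (`e^{2πi} = 1`)
  have hle :
      adjoin ℚ (Set.range (Fin.cons (2 * (Real.pi : ℂ) * Complex.I) u : Fin (r + 1) → ℂ) ∪
          Set.range
            (Complex.exp ∘ (Fin.cons (2 * (Real.pi : ℂ) * Complex.I) u : Fin (r + 1) → ℂ))) ≤
        adjoin ℚ (((({(2 * (Real.pi : ℂ) * Complex.I)} : Set ℂ) ∪
          Set.range fun i => Complex.exp (u i)) ∪ Set.range u)) := by
    rw [adjoin_le_iff]
    rintro a (⟨i, rfl⟩ | ⟨i, rfl⟩)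
    · refine Fin.cases ?_ (fun j => ?_) i
      · rw [Fin.cons_zero]
        exact subset_adjoin ℚ _ (Or.inl (Or.inl rfl))
      · rw [Fin.cons_succ]
        exact subset_adjoin ℚ _ (Or.inr ⟨j, rfl⟩)
    · refine Fin.cases ?_ (fun j => ?_) i
      · rw [Function.comp_apply, Fin.cons_zero, Complex.exp_two_pi_mul_I]
        exact one_mem _
      · rw [Function.comp_apply, Fin.cons_succ]
        exact subset_adjoin ℚ _ (Or.inl (Or.inr ⟨j, rfl⟩))
  -- (4) `u` is algebraic over `ℚ(2πi) ≤ ℚ(2πi, e^u)`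
  have hU : ∀ a ∈ Set.range u, IsAlgebraic
      (↥(adjoin ℚ ((({(2 * (Real.pi : ℂ) * Complex.I)} : Set ℂ) ∪
        Set.range fun i => Complex.exp (u i))))) a := by
    rintro _ ⟨i, rfl⟩
    exact isAlgebraic_of_le (adjoin.mono ℚ _ _ Set.subset_union_left) (mem_relAlg_iff.mp (hu i))
  -- (5) count (`trdeg_ℚ ℚ(2πi) ≤ 1`) and conclude
  have hcount := hcount_of (K := ℚ) ({(2 * (Real.pi : ℂ) * Complex.I)} : Set ℂ)
    (Set.range fun i => Complex.exp (u i)) (Set.range u)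
    (by rw [← Nat.cast_add_one]; exact hSx) hle hU
    (Literature.Barriers.Schanuel.trdeg_adjoin_singleton_le_one _)
  exact Literature.Barriers.Schanuel.algebraicIndependent_of_le_trdeg_adjoin _ hcount

end RelLWZeroOfSchanuelOnStageZero

/-- **Registered stub `stub_relLWZero_of_schanuelOnStageZero` of line `kernel-tower-relative-lw`**
(signature verbatim) — `SC|_{L₀} ⟹ RelLW₀`: under Schanuel's statement for `ℚ`-linearly
independent tuples from `L₀ = stage 0 = ℚ(2πi)^{ralg} = ℚ(π)^{ralg}`, exponentials of elements of
`L₀` that are `ℚ`-linearly independent modulo `ℚ·2πi` are algebraically independent over `L₀`.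
From `RelLWZeroOfSchanuelOnStageZero.algebraicIndependent_exp_over_adjoin` (independence over
`ℚ(2πi)`) by passing to the algebraic extension `L₀ = ℚ(2πi)^{ralg}` (Mathlib
`AlgebraicIndependent.algebraicClosure`).  With the skeleton's sorry-free level-`0` sector split
(`schanuelOnStageZero_of_relLWZero`) this certifies `RelLW₀ ⟺ SC|_{L₀}`: the first open layer of
the crux is exactly Schanuel's conjecture for `ℚ`-linearly independent tuples of numbers algebraic
over `ℚ(π)`. [folklore] -/
theorem stub_relLWZero_of_schanuelOnStageZero :
    (∀ (n : ℕ) (x : Fin n → ℂ), (∀ i, x i ∈ stage 0) → LinearIndependent ℚ x →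
      (n : Cardinal) ≤ Algebra.trdeg ℚ ↥(adjoin ℚ (Set.range x ∪ Set.range (Complex.exp ∘ x)))) →
      ∀ (r : ℕ) (u : Fin r → ℂ), (∀ i, u i ∈ stage 0) →
        LinearIndependent ℚ ((Submodule.span ℚ ({(2 * ↑Real.pi * Complex.I : ℂ)} : Set ℂ)).mkQ ∘ u) →
          AlgebraicIndependent (↥(stage 0)) (fun i => Complex.exp (u i)) := by
  intro hS0 r u hu hli
  exact (RelLWZeroOfSchanuelOnStageZero.algebraicIndependent_exp_over_adjoin
    hS0 r u hu hli).algebraicClosure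

/-- **`(R) ⟹ SC|_{L₀}`**: Schanuel's conjecture for the log-free core restricts to Schanuel's
statement for `ℚ`-linearly independent tuples from `L₀ = stage 0`, along `stage 0 ≤ logFreeCore`
(`stage_le_of_mem logFreeCore_mem_coreFamily 0`; the crux `SchanuelOnLogFreeCore` unfolds to
membership in `logFreeCore = sInf coreFamily` definitionally).  Composed with
`stub_relLWZero_of_schanuelOnStageZero` it re-derives the landed `stub_relLWZero_of_crux`.
[folklore] -/
theorem KernelTower.schanuelOnStageZero_of_crux :
    Summit.Schanuel.Schanuel.Theses.RigidCore.SchanuelOnLogFreeCore →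
      ∀ (n : ℕ) (x : Fin n → ℂ), (∀ i, x i ∈ stage 0) → LinearIndependent ℚ x →
        (n : Cardinal) ≤
          Algebra.trdeg ℚ ↥(adjoin ℚ (Set.range x ∪ Set.range (Complex.exp ∘ x))) := by
  intro hR n x hx hli
  exact hR n x (fun i => stage_le_of_mem logFreeCore_mem_coreFamily 0 (hx i)) hli

end Summit.Schanuel.Schanuel.Theorems.RigidCore

end
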